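import Literature.MathematicalPhysics.QuantumFieldTheory.BalabanImbrieJaffe1984to88.BIJ88SlotMomentsGauss308
import Literature.MathematicalPhysics.QuantumFieldTheory.BalabanImbrieJaffe1984to88.BIJ88RemainderW6Tsum

/-!
# `BalabanImbrieJaffe1984to88.BIJ88SlotConnectedGraph310` — [BalabanImbrieJaffe1988] CMP **114** (1988), Sect. 5.14 pp. 308–310 [PDF 52–54]:
**`Σ_γ ⟨(d/dt)_{γ_{j_1}}; …; (d/dt)_{γ_{j_n}}⟩_t = (d/dt)ⁿ log z_t` for the p. 308 family in the §5.13 Gaussian model WITH THE TRUNCATED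
FUNCTIONS OF p. 310 DISPLAY 3** (the connected-graph series), and r16's (5.14.2) remainder in that form.  The knit of this seat's gen-10 chain
(`BIJ88SlotLeibniz308`: p. 308 *"We express each d/dt as a sum Σ_γ (d/dt)_γ"* as Leibniz over assignments; `BIJ88SlotMoments308`: the slot
moments, `Σ_γ ⟨Π_{j∈K}(d/dt)_{γ_j}⟩_t = z_t^{(|K|)}/z_t`; `BIJ88SlotMomentsGauss308`: slot moments = p25's normalized corner expectations of the
derivative observables `fD`, `z_t > 0`) with p25's combinatorial chain (`BIJ88Expansion5143Ordered.Nsum_vsupp_eq_corner`: the prime-dropped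
expansion (5.14.3) over the virtual supports IS the un-normalized expectation; `BIJ88ConnectedGraphResummation`: displays 1–3 of p. 310;
`BIJ88RemainderW6Tsum.display2_Tsum`) — all consumed BY NAME, nothing restated.

statement-level skeleton of published theorems with citation tags; proofs where landed; nothing here is a claim about the Yang–Mills mass gap

CITATION HEADER (verbatim).  p. 308 [PDF 52] (`p0052.txt` L27–30): *"We express each d/dt as a sum Σ_γ (d/dt)_γ, where (d/dt)_γ acts only on
the t before a particular term V^{(k)}(Y) in Ṽ^{(k)} or in a particular χ-factor. We cluster expand as before each integral making up the
truncated expectation values ⟨(d/dt)_{γ_1}; … (d/dt)_{γ_{n̄+1}}⟩_t."*  p. 310 [PDF 54] (`p0054.txt` L5, L9–11, L13, L17–18, L24): *"This enables us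
to factor out the normalization z_t(Λ^{(k)}_{12}) to obtain* [display 1] *… The connected components of G define a partition of H which
corresponds to the partition in the formula* [display 2: ⟨Π_{j∈H}(d/dt)_{γ_j}⟩_t = Σ_{{H′_τ}∈𝒫(H)} Π_τ ⟨Π_{j∈H′_τ}[;(d/dt)_{γ_j}]⟩_t] *Thus we have
a formula* [display 3] *where G_c runs over connected graphs involving all clusters X_γ, Y_δ, and hence all of H. … It is now a standard exercise
to estimate the expansion, using (5.14.4)."*

WHAT IS REPRODUCED (unit `lit-balaban-p36`, generation 10 of the Phase-2 proof seat p36, file 4; SKELETON rows **C2.Claim@310** (displays 2–3,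
member), **C2.Eq5.14.1-5.14.2** ((5.14.2), member), **C2.Eq5.14.3-5.14.4** ((5.14.3), member) of `HOME/lit-balaban-r16/ROWS-C2-part2.md`; owner
r16, heads untouched; HOME `run/shared/lean/pub/lit-balaban/`).  Setting of `BIJ88SlotMomentsGauss308`: sites `α` in cubes `blk : α → I`,
coupling `Δ`, source `ℱ`, region `W`, abutting relation `adj`; the p. 308 family with χ-slots `b ∈ B` (fields `Φ_b`, constants `c_b`, profile `χ`,
`p`, `e_k`) and term slots `Y ∈ Ys` (terms `V_Y`), each slot `τ` in the cube `cube τ`; labels `L`, assignments `γ : L → ↥B ⊕ ↥Ys`.  The SLOT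
DATA of `γ` at time `t` is p25's `H ↦ zG blk Δ ℱ (fD (uD … t) cube γ H)`; its polymer bookkeeping is p25's: polymer family = the virtual supports
`(polysOf W).image (cvsupp adj W)`, localization `locv (cube ∘ γ)`, activity `wv (prime (g3 adj ·))`; `T_γ(K) := Tsum` of these = the
connected-graph series of display 3.  Theorems only (0 definitions):
* §1 `uD_local` (the derivative factors are cube-local for cube-local fields/terms), **`Nsum_vsupp_eq_zG_fD`** (`N_γ(K) = ⟨Π_{i∈W} fD_t γ K i⟩_{1,W}`:
  p25's `Nsum_vsupp_eq_corner` for the slot data — cluster factorization from `hΔ` + cube-locality, slot-locality from `fD_slot`),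
  `Nsum_vsupp_empty_pos` (the normalization `N_γ(∅) = z_t > 0` in the model — no smallness needed, cf. p25's `Nsum_empty_ne_zero_of_ineq5144`).
* §2 **`zG_fD_div_eq_sum_setPartitions_Tsum`** / `slotMoment_fieldLaw_eq_sum_setPartitions_Tsum` (display 2 with the display-3 truncations for
  the slot data of every assignment: `⟨Π_{j∈K}(d/dt)_{γ_j}⟩_t = Σ_{π∈𝒫(K)} Π_{b∈π} T_γ(b)` — the hypothesis `hκ` of the gen-10 knits HOLDS for
  `κ := T`), `trunc_eq_Tsum_of_display2` (display 3 as a theorem for the family: any `κ` solving display 2 against the slot moments IS `T_γ`,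
  p25's `display3`).
* §3 **`sum_asg_Tsum_eq_iteratedDeriv_log_zG`**: on the branch (`t` in a set of unique differentiability `s ⊆ (0, e^{−1}/e_k)`), for every
  nonempty `K ⊆ H`, `Σ_{γ ∈ asg s₀ K} T_γ(K) = (d/dt)^{|K|} log z_t`; all labels `sum_Tsum_univ_eq_iteratedDeriv_log_zG`.
* §4 **`remR_sum_Tsum_eq_integral_log_zG`**: `e_k < e^{−1}`, `|L| = n̄+1`: r16's `remR (Σ_{γ : L → slots} T_{γ,t}(L)) n̄ =
  −(1/(n̄+1)) ∫₀¹ ((1−t)^{n̄}/n̄!) ∂^{n̄+1}_{[0,1]} log z_t dt` (`BIJ88SlotMoments308.remR_sum_trunc_eq_zt` with `hzpos`, `hκ` DISCHARGED; the located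
  `(n̄+1)!` slip of the print is GAPS G-C2-p36-06).
HYPOTHESES, all explicit: structural (χ(1,·) ≥ 0, `p ≥ 0`, `W`-block of `Δ` positive definite, `Δ` couples abutting cubes only (`hΔ`), cubes of
the slots in `W`, cube-local CONTINUOUS fields with `Φ_b(0) = 0` (e.g. linear), `c_b ≥ c₀ > 0`, cube-local measurable terms `|V_Y| ≤ K_Y`,
`e_k > 0`) and **`hT`: the absolute convergence of the connected series `Σ_m ‖Tord_m(b)‖` of the nonempty sub-blocks for the slot data** — the
*"standard exercise … using (5.14.4)"*, NOT proved here (p25's `BIJ88RemainderW6Prime.summable_norm_Tord` does it from (5.14.4) in gens 5/6's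
plain-disjointness bookkeeping `polys R Λ`; for the virtual-support bookkeeping used here it is not in the tree).  Of the hypotheses `hN`, `hz`,
`hκ`, `hκloc` of gen 9's `…5142Slots.sum_asg_trunc_eq_iteratedDerivWithin_log` / `BIJ88RemainderW6Log` NONE remains in the model.
HONEST SCOPE: (a) finite-dimensional real Gaussian model of §5.13 as in p25's files (the constraint structure of the paper's measure not modelled);
(b) the branch `t > 0` only — the `t = 0` end ((5.14.1), `BIJ88SlotMoments308.effectiveAction_eq_pertP_add_sum_slotTrunc`) needs gen 8's centered
jointly Gaussian fields, not threaded to `fieldLaw` (mean `Δ⁻¹ℱ`); (c) (5.14.4), display 4 (`W₆′`) and bounds are neither used nor asserted.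
0 `sorry`, 0 definitions, 0 new `Prop` facts (D-0026); imports `BIJ88SlotMomentsGauss308`, `BIJ88RemainderW6Tsum`; modifies nothing.  PDF held:
`paper:balaban1988-cmp114-bij-abelian-higgs-effective-action` (journal page = PDF page + 256), pp. 308–310 read this session (text layer).  NOT
summit progress; NOT continuum; NOT Clay.  Cell `lit-balaban` Phase 2, seat p36 gen 10 (owner r16, referee ref-5).
-/

noncomputable section

namespace Literature.MathematicalPhysics.QuantumFieldTheory.BalabanImbrieJaffe1984to88.BIJ88SlotConnectedGraph310

open Finset MeasureTheory
open Literature.Probability.LatticeModels (IsSetPartition setPartitions mem_setPartitions)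
open Literature.MathematicalPhysics.QuantumFieldTheory.BalabanImbrieJaffe1984to88.BIJ88TruncatedExpectation5142 (asg asg_univ)
open BIJ88Clusters5134 (IsClusterFactorizing)
open BIJ88PolymerRep5134 (corner IsAdmissible)
open BIJ88PolymerRep5134Gauss (ext obs prec src expect zG isClusterFactorizing_zG)
open BIJ88Expansion5143 (g3 slotsIn prime IsSlotLocal)
open BIJ88Expansion5143Gauss (fD fD_local fD_slot isSlotLocal_zG)
open BIJ88Expansion5143Ordered (polysOf cvsupp locv wv Nsum_vsupp_eq_corner empty_notMem_image_vsupp)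
open BIJ88ConnectedGraphResummation (Nsum Tsum Tord display3)
open BIJ88RemainderW6Tsum (display2_Tsum)
open BIJ88SlotMoments308 (slotFactor zt slotMoment)
open BIJ88SlotMomentsGauss308 (fieldLaw uD isProbabilityMeasure_fieldLaw measurable_ext continuous_ext zt_fieldLaw_eq_zG
  slotMoment_fieldLaw_eq zG_fD_empty_pos sum_asg_trunc_eq_iteratedDeriv_log_zG')
open BIJ88Sect5Statements (CutoffProfile)
open BIJ88Sect5StatementsPart4 (remR)

variable {α I : Type} [Fintype α] [DecidableEq α] [Fintype I] [DecidableEq I]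
  (blk : α → I) (Δ : Matrix α α ℝ) (ℱ : α → ℝ) (W : Finset I) (adj : I → I → Prop) [DecidableRel adj]
variable (χ : CutoffProfile) {ι υ : Type*} [DecidableEq ι] [DecidableEq υ]
variable {p ek : ℝ} {B : Finset ι} {Φ : ι → (α → ℝ) → ℝ} {c : ι → ℝ} {Ys : Finset υ} {V : υ → (α → ℝ) → ℝ}
variable (cube : ↥B ⊕ ↥Ys → I)

/-! ## §1 The slot data of an assignment: cube-local derivative factors, cluster-factorizing slot-local corner expectations -/

omit [Fintype α] [DecidableEq α] [Fintype I] [DecidableEq I] [DecidableEq ι] [DecidableEq υ] in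
/-- **the derivative factors are cube-local** when the fields `Φ_b` and the terms `V_Y` are local in the cube of their slot (p. 308: *"(d/dt)_γ
acts only on the t before a particular term V^{(k)}(Y) in Ṽ^{(k)} or in a particular χ-factor"* — and that factor lives in one cube).
[cite: BalabanImbrieJaffe1988, (5.14.3) p.309] -/
theorem uD_local (hΦloc : ∀ b : B, ∀ φ ψ : α → ℝ, (∀ x, blk x = cube (Sum.inl b) → φ x = ψ x) → Φ b φ = Φ b ψ)
    (hVloc : ∀ Y : Ys, ∀ φ ψ : α → ℝ, (∀ x, blk x = cube (Sum.inr Y) → φ x = ψ x) → V Y φ = V Y ψ) (t : ℝ) (τ : ↥B ⊕ ↥Ys) (m : ℕ)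
    (φ ψ : α → ℝ) (h : ∀ x, blk x = cube τ → φ x = ψ x) : uD χ p ek B Φ c Ys V t τ m φ = uD χ p ek B Φ c Ys V t τ m ψ := by
  rcases τ with b | Y
  · simp only [uD, BIJ88SlotMoments308.slotFactor_inl, hΦloc b φ ψ h]
  · simp only [uD, BIJ88SlotMoments308.slotFactor_inr, hVloc Y φ ψ h]

/-- **`N_γ(K) = ⟨Π_{i∈W} fD_t γ K i⟩_{1,W}`**: p25's ordered polymer sum `Nsum` of p. 309 (last display) over the VIRTUAL SUPPORTS of the polymers of
`W`, localization `j ↦ □(γ_j)`, activity the prime-dropped `g₃′` of the corner expectations of the derivative observables of the assignment `γ`, IS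
the un-normalized expectation `⟨Π_{j∈K}(d/dt)_{γ_j} χ′ e^{−tṼ}⟩_{1,W}` of the p. 308 family in the §5.13 model (`BIJ88Expansion5143Ordered.Nsum_vsupp_eq_corner`
for this slot data: `Δ` couples only abutting cubes, cube-local fields and terms, cubes of the slots in `W`).
[cite: BalabanImbrieJaffe1988, (5.14.3) p.309; p.309 last display] -/
theorem Nsum_vsupp_eq_zG_fD (hΔ : ∀ x y, blk x ≠ blk y → ¬ adj (blk x) (blk y) → Δ x y = 0) (hcube : ∀ τ, cube τ ∈ W)
    (hΦloc : ∀ b : B, ∀ φ ψ : α → ℝ, (∀ x, blk x = cube (Sum.inl b) → φ x = ψ x) → Φ b φ = Φ b ψ)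
    (hVloc : ∀ Y : Ys, ∀ φ ψ : α → ℝ, (∀ x, blk x = cube (Sum.inr Y) → φ x = ψ x) → V Y φ = V Y ψ) (t : ℝ) {L : Type*} [Fintype L]
    [DecidableEq L] (γ : L → ↥B ⊕ ↥Ys) (K : Finset L) :
    Nsum ((polysOf W).image (cvsupp adj W)) (locv (cube ∘ γ))
        (wv (prime (g3 adj fun H => zG blk Δ ℱ (fD (uD χ p ek B Φ c Ys V t) cube γ H)))) K =
      zG blk Δ ℱ (fD (uD χ p ek B Φ c Ys V t) cube γ K) W W :=
  Nsum_vsupp_eq_corner (z := fun H => zG blk Δ ℱ (fD (uD χ p ek B Φ c Ys V t) cube γ H))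
    (isClusterFactorizing_zG blk Δ ℱ _ adj hΔ (fD_local blk γ (uD_local blk χ cube hΦloc hVloc t) K))
    (isSlotLocal_zG blk Δ ℱ (cube ∘ γ) _ fun H i => fD_slot _ cube γ H i) fun j _ => hcube (γ j)


/-- **the normalization is positive, `N_γ(∅) = z_t > 0`, in the model** (`χ(1,·) ≥ 0`, `p ≥ 0`, `W`-block of `Δ` positive definite, continuous
cube-local fields vanishing at `0`, `c_b ≥ c₀ > 0`, measurable cube-local terms `|V_Y| ≤ K_Y`, `0 < t`, `te_k ≤ e^{−1}`) — NO smallness needed here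
(p25's `BIJ88RemainderW6Tsum.Nsum_empty_ne_zero_of_ineq5144` gets `≠ 0` from (5.14.4) in gens 5/6's bookkeeping); §1 and
`BIJ88SlotMomentsGauss308.zG_fD_empty_pos`. [cite: BalabanImbrieJaffe1988, p.310 display 1; (5.14.2) p.308] -/
theorem Nsum_vsupp_empty_pos (hχ : ∀ x, 0 ≤ χ.χ₁ x) (hp : 0 ≤ p)
    (hΔ : ∀ x y, blk x ≠ blk y → ¬ adj (blk x) (blk y) → Δ x y = 0) (hPD : (prec blk Δ W (corner ℝ W)).PosDef)
    (hcube : ∀ τ, cube τ ∈ W)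
    (hΦloc : ∀ b : B, ∀ φ ψ : α → ℝ, (∀ x, blk x = cube (Sum.inl b) → φ x = ψ x) → Φ b φ = Φ b ψ)
    (hVloc : ∀ Y : Ys, ∀ φ ψ : α → ℝ, (∀ x, blk x = cube (Sum.inr Y) → φ x = ψ x) → V Y φ = V Y ψ)
    (hΦc : ∀ b ∈ B, Continuous (Φ b)) (hΦ0 : ∀ b ∈ B, Φ b 0 = 0) {c₀ : ℝ} (hc₀ : 0 < c₀) (hcb : ∀ b ∈ B, c₀ ≤ c b)
    (hV : ∀ Y ∈ Ys, Measurable (V Y)) {KY : υ → ℝ} (hK : ∀ Y ∈ Ys, ∀ φ, |V Y φ| ≤ KY Y) (hek : 0 < ek) {L : Type*} [Fintype L]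
    [DecidableEq L] (γ : L → ↥B ⊕ ↥Ys) {t : ℝ} (ht : 0 < t) (h1 : t * ek ≤ Real.exp (-1)) :
    0 < Nsum ((polysOf W).image (cvsupp adj W)) (locv (cube ∘ γ))
      (wv (prime (g3 adj fun H => zG blk Δ ℱ (fD (uD χ p ek B Φ c Ys V t) cube γ H)))) ∅ := by
  rw [Nsum_vsupp_eq_zG_fD blk Δ ℱ W adj χ cube hΔ hcube hΦloc hVloc t γ ∅]
  exact zG_fD_empty_pos blk Δ ℱ W χ cube hχ hp hPD hcube hΦc hΦ0 hc₀ hcb hV hK hek γ ht h1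

/-! ## §2 Display 2 of p. 310 with the display-3 truncations, for the slot data of every assignment -/

/-- **`⟨Π_{j∈K}(d/dt)_{γ_j}⟩_t = Σ_{π∈𝒫(K)} Π_{b∈π} T_γ(b)` in the model**: the normalized corner expectation
`⟨Π_i fD_t γ K i⟩_{1,W} / ⟨Π_i fD_t γ ∅ i⟩_{1,W}` equals the sum over the set partitions of `K` of the products of the CONNECTED-GRAPH SERIES of
p. 310 display 3 (p25's `Tsum`, same slot data) of the blocks — p25's `display2_Tsum` (displays 1–2) read through §1, under the normalization
`≠ 0` and the absolute convergence of the connected series of the nonempty sub-blocks (the *"standard exercise"*, displayed).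
[cite: BalabanImbrieJaffe1988, p.310 displays 1–3; (5.14.3) p.309] -/
theorem zG_fD_div_eq_sum_setPartitions_Tsum (hΔ : ∀ x y, blk x ≠ blk y → ¬ adj (blk x) (blk y) → Δ x y = 0)
    (hcube : ∀ τ, cube τ ∈ W)
    (hΦloc : ∀ b : B, ∀ φ ψ : α → ℝ, (∀ x, blk x = cube (Sum.inl b) → φ x = ψ x) → Φ b φ = Φ b ψ)
    (hVloc : ∀ Y : Ys, ∀ φ ψ : α → ℝ, (∀ x, blk x = cube (Sum.inr Y) → φ x = ψ x) → V Y φ = V Y ψ) {t : ℝ} {L : Type*} [Fintype L]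
    [DecidableEq L] (γ : L → ↥B ⊕ ↥Ys) (hz : zG blk Δ ℱ (fD (uD χ p ek B Φ c Ys V t) cube γ ∅) W W ≠ 0) {K : Finset L}
    (hT : ∀ b ⊆ K, b.Nonempty → Summable fun m => ‖Tord ((polysOf W).image (cvsupp adj W)) (locv (cube ∘ γ))
      (wv (prime (g3 adj fun H => zG blk Δ ℱ (fD (uD χ p ek B Φ c Ys V t) cube γ H)))) m b‖) :
    zG blk Δ ℱ (fD (uD χ p ek B Φ c Ys V t) cube γ K) W W / zG blk Δ ℱ (fD (uD χ p ek B Φ c Ys V t) cube γ ∅) W W =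
      ∑ π ∈ setPartitions K, ∏ b ∈ π, Tsum ((polysOf W).image (cvsupp adj W)) (locv (cube ∘ γ))
        (wv (prime (g3 adj fun H => zG blk Δ ℱ (fD (uD χ p ek B Φ c Ys V t) cube γ H)))) b := by
  rw [← Nsum_vsupp_eq_zG_fD blk Δ ℱ W adj χ cube hΔ hcube hΦloc hVloc t γ K,
    ← Nsum_vsupp_eq_zG_fD blk Δ ℱ W adj χ cube hΔ hcube hΦloc hVloc t γ ∅]
  refine display2_Tsum empty_notMem_image_vsupp ?_ hT
  rwa [Nsum_vsupp_eq_zG_fD blk Δ ℱ W adj χ cube hΔ hcube hΦloc hVloc t γ ∅]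

/-- **… and for the slot moments of `BIJ88SlotMoments308`** (the Gaussian law of the fields of `W`, fields and terms read through the extension
map): `⟨Π_{j∈K}(d/dt)_{γ_j}⟩_t = Σ_{π∈𝒫(K)} Π_{b∈π} T_γ(b)` — the hypothesis `hκ` of `BIJ88SlotMoments308.sum_asg_trunc_eq_iteratedDeriv_log_zt` /
`remR_sum_trunc_eq_zt` HOLDS for `κ := ` the connected-graph series. [cite: BalabanImbrieJaffe1988, p.310 displays 1–3; (5.14.3) p.309] -/
theorem slotMoment_fieldLaw_eq_sum_setPartitions_Tsum (hΔ : ∀ x y, blk x ≠ blk y → ¬ adj (blk x) (blk y) → Δ x y = 0)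
    (hcube : ∀ τ, cube τ ∈ W)
    (hΦloc : ∀ b : B, ∀ φ ψ : α → ℝ, (∀ x, blk x = cube (Sum.inl b) → φ x = ψ x) → Φ b φ = Φ b ψ)
    (hVloc : ∀ Y : Ys, ∀ φ ψ : α → ℝ, (∀ x, blk x = cube (Sum.inr Y) → φ x = ψ x) → V Y φ = V Y ψ) {t : ℝ} {L : Type*} [Fintype L]
    [DecidableEq L] (γ : L → ↥B ⊕ ↥Ys) (hz : zG blk Δ ℱ (fD (uD χ p ek B Φ c Ys V t) cube γ ∅) W W ≠ 0) {K : Finset L}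
    (hT : ∀ b ⊆ K, b.Nonempty → Summable fun m => ‖Tord ((polysOf W).image (cvsupp adj W)) (locv (cube ∘ γ))
      (wv (prime (g3 adj fun H => zG blk Δ ℱ (fD (uD χ p ek B Φ c Ys V t) cube γ H)))) m b‖) :
    slotMoment χ p ek B (fun b ω => Φ b (ext blk W ω)) c Ys (fun Y ω => V Y (ext blk W ω)) (fieldLaw blk Δ ℱ W) t K γ =
      ∑ π ∈ setPartitions K, ∏ b ∈ π, Tsum ((polysOf W).image (cvsupp adj W)) (locv (cube ∘ γ))
        (wv (prime (g3 adj fun H => zG blk Δ ℱ (fD (uD χ p ek B Φ c Ys V t) cube γ H)))) b := by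
  rw [slotMoment_fieldLaw_eq blk Δ ℱ W χ p ek B Φ c Ys V cube hcube t K γ]
  exact zG_fD_div_eq_sum_setPartitions_Tsum blk Δ ℱ W adj χ cube hΔ hcube hΦloc hVloc γ hz hT


/-- **DISPLAY 3 OF p. 310 AS A THEOREM FOR THE FAMILY** (*"Thus we have a formula … where G_c runs over connected graphs involving all clusters
X_γ, Y_δ, and hence all of H"*): ANY family `κ` of truncated functions related to the slot moments `⟨Π_{j∈K}(d/dt)_{γ_j}⟩_t` of the assignment `γ`
by display 2 on the nonempty `K ⊆ H` (the inductive DEFINITION of `⟨…;…⟩_t`) IS the connected-graph series of the slot data: `κ(K) = T_γ(K)` for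
all nonempty `K ⊆ H` — p25's `display3` (Möbius inversion over set partitions) read through §1 and `BIJ88SlotMomentsGauss308.slotMoment_fieldLaw_eq`.
[cite: BalabanImbrieJaffe1988, p.310 displays 1–3; (5.14.3) p.309] -/
theorem trunc_eq_Tsum_of_display2 (hΔ : ∀ x y, blk x ≠ blk y → ¬ adj (blk x) (blk y) → Δ x y = 0) (hcube : ∀ τ, cube τ ∈ W)
    (hΦloc : ∀ b : B, ∀ φ ψ : α → ℝ, (∀ x, blk x = cube (Sum.inl b) → φ x = ψ x) → Φ b φ = Φ b ψ)
    (hVloc : ∀ Y : Ys, ∀ φ ψ : α → ℝ, (∀ x, blk x = cube (Sum.inr Y) → φ x = ψ x) → V Y φ = V Y ψ) {t : ℝ} {L : Type*} [Fintype L]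
    [DecidableEq L] (γ : L → ↥B ⊕ ↥Ys) (hz : zG blk Δ ℱ (fD (uD χ p ek B Φ c Ys V t) cube γ ∅) W W ≠ 0) {H : Finset L}
    (hT : ∀ b ⊆ H, b.Nonempty → Summable fun m => ‖Tord ((polysOf W).image (cvsupp adj W)) (locv (cube ∘ γ))
      (wv (prime (g3 adj fun H' => zG blk Δ ℱ (fD (uD χ p ek B Φ c Ys V t) cube γ H')))) m b‖) (κ : Finset L → ℝ)
    (hκ : ∀ K ⊆ H, K.Nonempty →
      slotMoment χ p ek B (fun b ω => Φ b (ext blk W ω)) c Ys (fun Y ω => V Y (ext blk W ω)) (fieldLaw blk Δ ℱ W) t K γ =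
        ∑ π ∈ setPartitions K, ∏ b ∈ π, κ b) :
    ∀ K ⊆ H, K.Nonempty → κ K = Tsum ((polysOf W).image (cvsupp adj W)) (locv (cube ∘ γ))
      (wv (prime (g3 adj fun H' => zG blk Δ ℱ (fD (uD χ p ek B Φ c Ys V t) cube γ H')))) K := by
  intro K hKH hK
  refine display3 _ _ _ K hK empty_notMem_image_vsupp ?_ (fun b hb hne => hT b (hb.trans hKH) hne) κ fun K' hK'K hK' => ?_
  · rwa [Nsum_vsupp_eq_zG_fD blk Δ ℱ W adj χ cube hΔ hcube hΦloc hVloc t γ ∅]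
  · rw [Nsum_vsupp_eq_zG_fD blk Δ ℱ W adj χ cube hΔ hcube hΦloc hVloc t γ K',
      Nsum_vsupp_eq_zG_fD blk Δ ℱ W adj χ cube hΔ hcube hΦloc hVloc t γ ∅,
      ← slotMoment_fieldLaw_eq blk Δ ℱ W χ p ek B Φ c Ys V cube hcube t K' γ]
    exact hκ K' (hK'K.trans hKH) hK'

/-! ## §3 `Σ_γ ⟨(d/dt)_{γ_{j_1}}; … ⟩_t = (d/dt)^{|K|} log z_t` with the truncated functions of display 3 -/

/-- **`Σ_{γ ∈ asg s₀ K} T_γ(K) = (d/dt)^{|K|} log z_t` IN THE MODEL, on the branch** `t ∈ s`, `s ⊆ (0, e^{−1}/e_k)` a set of unique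
differentiability: the p. 308 decomposition `d/dt = Σ_γ (d/dt)_γ` (`BIJ88SlotLeibniz308`), the slot moments `= z_t^{(|K|)}/z_t` summed
(`BIJ88SlotMoments308`), their identification with p25's corner expectations and the positivity of `z_t` (`BIJ88SlotMomentsGauss308`), display
(5.14.3) and displays 1–3 of p. 310 (p25) KNIT: for every nonempty `K ⊆ H`, the connected-graph series of display 3 of the slot data of the
assignments, summed over the assignments of the labels of `K` (the others pinned at `s₀`), is the `|K|`-th derivative of `log z_t`.  Hypotheses:
structural (χ ≥ 0, `p ≥ 0`, `W`-block of `Δ` positive definite, `Δ` couples abutting cubes only, cubes of the slots in `W`, cube-local continuous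
fields vanishing at `0`, `c_b ≥ c₀ > 0`, cube-local measurable terms `|V_Y| ≤ K_Y`, `e_k > 0`) and the absolute convergence `hT` of the
connected series (the *"standard exercise"* via (5.14.4), NOT proved here). [cite: BalabanImbrieJaffe1988, (5.14.2) p.308; (5.14.3) p.309; p.310 displays 1–3] -/
theorem sum_asg_Tsum_eq_iteratedDeriv_log_zG (hχ : ∀ x, 0 ≤ χ.χ₁ x) (hp : 0 ≤ p)
    (hΔ : ∀ x y, blk x ≠ blk y → ¬ adj (blk x) (blk y) → Δ x y = 0) (hPD : (prec blk Δ W (corner ℝ W)).PosDef)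
    (hcube : ∀ τ, cube τ ∈ W)
    (hΦloc : ∀ b : B, ∀ φ ψ : α → ℝ, (∀ x, blk x = cube (Sum.inl b) → φ x = ψ x) → Φ b φ = Φ b ψ)
    (hVloc : ∀ Y : Ys, ∀ φ ψ : α → ℝ, (∀ x, blk x = cube (Sum.inr Y) → φ x = ψ x) → V Y φ = V Y ψ)
    (hΦc : ∀ b ∈ B, Continuous (Φ b)) (hΦ0 : ∀ b ∈ B, Φ b 0 = 0) {c₀ : ℝ} (hc₀ : 0 < c₀) (hcb : ∀ b ∈ B, c₀ ≤ c b)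
    (hV : ∀ Y ∈ Ys, Measurable (V Y)) {KY : υ → ℝ} (hK : ∀ Y ∈ Ys, ∀ φ, |V Y φ| ≤ KY Y) (hek : 0 < ek) {s : Set ℝ}
    (hs : UniqueDiffOn ℝ s) (hsub : s ⊆ Set.Ioo 0 (Real.exp (-1) / ek)) {L : Type*} [Fintype L] [DecidableEq L]
    (s₀ : ↥B ⊕ ↥Ys) (γ₀ : L → ↥B ⊕ ↥Ys) {H : Finset L} {t : ℝ} (ht : t ∈ s)
    (hT : ∀ γ : L → ↥B ⊕ ↥Ys, ∀ b ⊆ H, b.Nonempty → Summable fun m => ‖Tord ((polysOf W).image (cvsupp adj W)) (locv (cube ∘ γ))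
      (wv (prime (g3 adj fun H' => zG blk Δ ℱ (fD (uD χ p ek B Φ c Ys V t) cube γ H')))) m b‖) :
    ∀ K ⊆ H, K.Nonempty →
      ∑ γ ∈ asg s₀ K, Tsum ((polysOf W).image (cvsupp adj W)) (locv (cube ∘ γ))
          (wv (prime (g3 adj fun H' => zG blk Δ ℱ (fD (uD χ p ek B Φ c Ys V t) cube γ H')))) K =
        iteratedDeriv K.card (fun x => Real.log (zG blk Δ ℱ (fD (uD χ p ek B Φ c Ys V x) cube γ₀ ∅) W W)) t :=
  sum_asg_trunc_eq_iteratedDeriv_log_zG' blk Δ ℱ W χ cube hχ hp hPD hcube hΦc hΦ0 hc₀ hcb hV hK hek hs hsub s₀ γ₀ ht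
    (κ := fun A γ => Tsum ((polysOf W).image (cvsupp adj W)) (locv (cube ∘ γ))
      (wv (prime (g3 adj fun H' => zG blk Δ ℱ (fD (uD χ p ek B Φ c Ys V t) cube γ H')))) A)
    fun γ K hKH _ => zG_fD_div_eq_sum_setPartitions_Tsum blk Δ ℱ W adj χ cube hΔ hcube hΦloc hVloc γ
      (zG_fD_empty_pos blk Δ ℱ W χ cube hχ hp hPD hcube hΦc hΦ0 hc₀ hcb hV hK hek γ (hsub ht).1
        (by rw [← le_div_iff₀ hek]; exact (hsub ht).2.le)).ne'
      fun b hb hne => hT γ b (hb.trans hKH) hne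

/-- **All labels: `Σ_{γ : H → slots} T_γ(H) = (d/dt)ⁿ log z_t`** (`n = |H| ≥ 1`), same hypotheses. [cite: BalabanImbrieJaffe1988, (5.14.2) p.308; p.310 displays 1–3] -/
theorem sum_Tsum_univ_eq_iteratedDeriv_log_zG (hχ : ∀ x, 0 ≤ χ.χ₁ x) (hp : 0 ≤ p)
    (hΔ : ∀ x y, blk x ≠ blk y → ¬ adj (blk x) (blk y) → Δ x y = 0) (hPD : (prec blk Δ W (corner ℝ W)).PosDef)
    (hcube : ∀ τ, cube τ ∈ W)
    (hΦloc : ∀ b : B, ∀ φ ψ : α → ℝ, (∀ x, blk x = cube (Sum.inl b) → φ x = ψ x) → Φ b φ = Φ b ψ)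
    (hVloc : ∀ Y : Ys, ∀ φ ψ : α → ℝ, (∀ x, blk x = cube (Sum.inr Y) → φ x = ψ x) → V Y φ = V Y ψ)
    (hΦc : ∀ b ∈ B, Continuous (Φ b)) (hΦ0 : ∀ b ∈ B, Φ b 0 = 0) {c₀ : ℝ} (hc₀ : 0 < c₀) (hcb : ∀ b ∈ B, c₀ ≤ c b)
    (hV : ∀ Y ∈ Ys, Measurable (V Y)) {KY : υ → ℝ} (hK : ∀ Y ∈ Ys, ∀ φ, |V Y φ| ≤ KY Y) (hek : 0 < ek) {s : Set ℝ}
    (hs : UniqueDiffOn ℝ s) (hsub : s ⊆ Set.Ioo 0 (Real.exp (-1) / ek)) {L : Type*} [Fintype L] [DecidableEq L] [Nonempty L]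
    (γ₀ : L → ↥B ⊕ ↥Ys) {t : ℝ} (ht : t ∈ s)
    (hT : ∀ γ : L → ↥B ⊕ ↥Ys, ∀ b : Finset L, b.Nonempty → Summable fun m => ‖Tord ((polysOf W).image (cvsupp adj W)) (locv (cube ∘ γ))
      (wv (prime (g3 adj fun H' => zG blk Δ ℱ (fD (uD χ p ek B Φ c Ys V t) cube γ H')))) m b‖) :
    ∑ γ : L → ↥B ⊕ ↥Ys, Tsum ((polysOf W).image (cvsupp adj W)) (locv (cube ∘ γ))
        (wv (prime (g3 adj fun H' => zG blk Δ ℱ (fD (uD χ p ek B Φ c Ys V t) cube γ H')))) univ =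
      iteratedDeriv (Fintype.card L) (fun x => Real.log (zG blk Δ ℱ (fD (uD χ p ek B Φ c Ys V x) cube γ₀ ∅) W W)) t := by
  have h := sum_asg_Tsum_eq_iteratedDeriv_log_zG blk Δ ℱ W adj χ cube hχ hp hΔ hPD hcube hΦloc hVloc hΦc hΦ0 hc₀ hcb hV hK hek hs
    hsub (γ₀ (Classical.arbitrary L)) γ₀ (H := univ) ht (fun γ b _ hne => hT γ b hne) univ Subset.rfl univ_nonempty
  rwa [asg_univ, card_univ] at h

/-! ## §4 r16's printed (5.14.2) remainder for the family in the model, truncated functions = display 3 -/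

/-- **(5.14.2) IN THE MODEL WITH THE TRUNCATED FUNCTIONS OF DISPLAY 3**: `e_k < e^{−1}` (so the branch contains `(0,1]`), `|L| = n̄+1` labels;
for `⟨d/dt; …; d/dt⟩_t := Σ_{γ : L → slots} T_{γ,t}(L)` (the connected-graph series of p. 310 display 3 of the slot data at time `t`), r16's
remainder `remR` of (5.14.2) equals `−(1/(n̄+1)) ∫₀¹ ((1−t)^{n̄}/n̄!) (d/dt)^{n̄+1} log z_t dt` (derivative within `[0,1]`; the located `(n̄+1)!`
slip of the print, GAPS G-C2-p36-06) — `BIJ88SlotMoments308.remR_sum_trunc_eq_zt` for the Gaussian law of the fields of `W`, its hypotheses `hzpos`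
(positivity) and `hκ` (display 2) DISCHARGED by `BIJ88SlotMomentsGauss308.zG_fD_empty_pos` and §2; remaining: the structural hypotheses and the
absolute convergence `hT` of the connected series on `(0,1]`. [cite: BalabanImbrieJaffe1988, (5.14.2) p.308; (5.14.3) p.309; p.310 displays 1–3] -/
theorem remR_sum_Tsum_eq_integral_log_zG (hχ : ∀ x, 0 ≤ χ.χ₁ x) (hp : 0 ≤ p)
    (hΔ : ∀ x y, blk x ≠ blk y → ¬ adj (blk x) (blk y) → Δ x y = 0) (hPD : (prec blk Δ W (corner ℝ W)).PosDef)
    (hcube : ∀ τ, cube τ ∈ W)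
    (hΦloc : ∀ b : B, ∀ φ ψ : α → ℝ, (∀ x, blk x = cube (Sum.inl b) → φ x = ψ x) → Φ b φ = Φ b ψ)
    (hVloc : ∀ Y : Ys, ∀ φ ψ : α → ℝ, (∀ x, blk x = cube (Sum.inr Y) → φ x = ψ x) → V Y φ = V Y ψ)
    (hΦc : ∀ b ∈ B, Continuous (Φ b)) (hΦ0 : ∀ b ∈ B, Φ b 0 = 0) {c₀ : ℝ} (hc₀ : 0 < c₀) (hcb : ∀ b ∈ B, c₀ ≤ c b)
    (hV : ∀ Y ∈ Ys, Measurable (V Y)) {KY : υ → ℝ} (hK : ∀ Y ∈ Ys, ∀ φ, |V Y φ| ≤ KY Y) (hek : 0 < ek)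
    (hek1 : ek < Real.exp (-1)) {L : Type*} [Fintype L] [DecidableEq L] {nbar : ℕ} (hL : Fintype.card L = nbar + 1)
    (γ₀ : L → ↥B ⊕ ↥Ys)
    (hT : ∀ t ∈ Set.Ioc (0 : ℝ) 1, ∀ γ : L → ↥B ⊕ ↥Ys, ∀ b : Finset L, b.Nonempty →
      Summable fun m => ‖Tord ((polysOf W).image (cvsupp adj W)) (locv (cube ∘ γ))
        (wv (prime (g3 adj fun H' => zG blk Δ ℱ (fD (uD χ p ek B Φ c Ys V t) cube γ H')))) m b‖) :
    remR (fun t => ∑ γ : L → ↥B ⊕ ↥Ys, Tsum ((polysOf W).image (cvsupp adj W)) (locv (cube ∘ γ))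
        (wv (prime (g3 adj fun H' => zG blk Δ ℱ (fD (uD χ p ek B Φ c Ys V t) cube γ H')))) univ) nbar =
      -(1 / (nbar + 1 : ℝ)) * ∫ t in (0 : ℝ)..1, ((1 - t) ^ nbar / nbar.factorial) *
        iteratedDerivWithin (nbar + 1) (fun x => Real.log (zG blk Δ ℱ (fD (uD χ p ek B Φ c Ys V x) cube γ₀ ∅) W W))
          (Set.uIcc 0 1) t := by
  haveI := isProbabilityMeasure_fieldLaw blk Δ ℱ W hPD
  haveI : Nonempty L := Fintype.card_pos_iff.1 (by omega)
  have hΦ' : ∀ b ∈ B, Measurable fun ω : {x : α // blk x ∈ W} → ℝ => Φ b (ext blk W ω) := fun b hb =>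
    ((hΦc b hb).comp (continuous_ext blk W)).measurable
  have hV' : ∀ Y ∈ Ys, Measurable fun ω : {x : α // blk x ∈ W} → ℝ => V Y (ext blk W ω) := fun Y hY =>
    (hV Y hY).comp (measurable_ext blk W)
  have hc : ∀ b ∈ B, c b ≠ 0 := fun b hb => (hc₀.trans_le (hcb b hb)).ne'
  have hz : zt χ p ek B (fun b ω => Φ b (ext blk W ω)) c Ys (fun Y ω => V Y (ext blk W ω)) (fieldLaw blk Δ ℱ W) =
      fun t' => zG blk Δ ℱ (fD (uD χ p ek B Φ c Ys V t') cube γ₀ ∅) W W :=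
    funext fun t' => zt_fieldLaw_eq_zG blk Δ ℱ W χ p ek B Φ c Ys V cube hcube γ₀ t'
  have hpos : ∀ x ∈ Set.Ioc (0 : ℝ) 1, ∀ γ : L → ↥B ⊕ ↥Ys, 0 < zG blk Δ ℱ (fD (uD χ p ek B Φ c Ys V x) cube γ ∅) W W :=
    fun x hx γ => zG_fD_empty_pos blk Δ ℱ W χ cube hχ hp hPD hcube hΦc hΦ0 hc₀ hcb hV hK hek γ hx.1
      (BIJ88ZtPositivity308.mul_le_exp_neg_one_of_Ioc hek hek1.le hx)
  have h := BIJ88SlotMoments308.remR_sum_trunc_eq_zt χ (p := p) (fieldLaw blk Δ ℱ W) hΦ' hc hV' (fun Y hY ω => hK Y hY _) hek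
    hek1 (fun x hx => by rw [hz]; exact hpos x hx γ₀) hL (γ₀ (Classical.arbitrary L))
    (κ := fun t A γ => Tsum ((polysOf W).image (cvsupp adj W)) (locv (cube ∘ γ))
      (wv (prime (g3 adj fun H' => zG blk Δ ℱ (fD (uD χ p ek B Φ c Ys V t) cube γ H')))) A)
    fun t ht γ K _ => slotMoment_fieldLaw_eq_sum_setPartitions_Tsum blk Δ ℱ W adj χ cube hΔ hcube hΦloc hVloc γ (hpos t ht γ).ne'
      fun b _ hne => hT t ht γ b hne
  rwa [hz] at h

end Literature.MathematicalPhysics.QuantumFieldTheory.BalabanImbrieJaffe1984to88.BIJ88SlotConnectedGraph310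

end
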